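import Summits.KontsevichZagierPeriods.KontsevichZagierPeriods.Theorems.PentagonInKZ.Negative.WeightThreeFaithful

/-!
# `PentagonInKZ` — negative lane, §16g: the duality MOVE at weight 3 and UNCONDITIONAL tightness
# modulo weight 4

Standing adversary (cdisprove seat, generation 3) on the crux `PentagonInKZ`
(stmt-KontsevichZagierPeriods-11348).

* `mzvRep_three_sub_twoOne_mem_relations`: **`[Δ₃, ω₀ω₀ω₁] - [Δ₃, ω₀ω₁ω₁] ∈ KZ.relations`** —
  Euler's `ζ(3) = ζ(2,1)` is ONE change of variables of the KZ calculus, the involution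
  `t ↦ (1 - t₂, 1 - t₁, 1 - t₀)` of the open ordered simplex (`ℚ`-polynomial, `|det| = 1`), the
  instance `s = (3)` of the support item `DualityInKZ` (stmt-KontsevichZagierPeriods-3933).
* Hence `χ⟦ζ(3)⟧ = χ⟦ζ(2,1)⟧` in EVERY realisation (`chi_Z3_eq_Z21`), and with
  `Negative/WeightThreeFaithful.lean`:
  **the crux `PentagonInKZ` HOLDS UNCONDITIONALLY MODULO WEIGHT 4** — for every realisation `χ`
  and agreeing `Z`, `Φ_χ` satisfies Drinfeld's pentagon identity in all truncations `N ≤ 3`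
  (`pentAt_le_three`).  The first rung at which the crux can fail (equivalently, by
  `pentagonInKZ_of_summit`, at which the period conjecture could be refuted through it) is
  weight 4, whose exact content is `weight_four_content` (`Negative/LowWeight.lean`).
-/

noncomputable section

open Literature.NumberTheory.Transcendental
open MeasureTheory Set

namespace Summit.KontsevichZagierPeriods.FurushoPentagon.PentagonInKZNegative

open Summit.KontsevichZagierPeriods.KontsevichZagierPeriods.Theses.FurushoPentagon (PentagonInKZ)

/-! ## §16g The duality involution of the ordered simplex -/

/-- The duality involution `t ↦ (1 - t_{n-1-j})_j` of `ℝⁿ`. [cite: Zagier1994, §9] -/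
def dualMap (n : ℕ) (t : Fin n → ℝ) : Fin n → ℝ := fun j => 1 - t (Fin.rev j)

/-- Its linear part `v ↦ (-v_{n-1-j})_j`. [folklore] -/
def dualLin (n : ℕ) : (Fin n → ℝ) →L[ℝ] (Fin n → ℝ) :=
  -ContinuousLinearMap.pi fun j => ContinuousLinearMap.proj (Fin.rev j)

/-- `dualLin v = (-v_{rev j})_j`. [folklore] -/
theorem dualLin_apply (n : ℕ) (v : Fin n → ℝ) : dualLin n v = fun j => -v (Fin.rev j) := by
  ext j; simp [dualLin]

/-- `dualMap` is an involution. [cite: Zagier1994, §9] -/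
theorem dualMap_dualMap (n : ℕ) (t : Fin n → ℝ) : dualMap n (dualMap n t) = t := by
  ext j; simp [dualMap, Fin.rev_rev]

/-- `dualMap = 1 + dualLin`. [folklore] -/
theorem dualMap_eq (n : ℕ) (t : Fin n → ℝ) : dualMap n t = (fun _ => (1 : ℝ)) + dualLin n t := by
  ext j; simp [dualMap, dualLin_apply, sub_eq_add_neg]

/-- `dualMap` is differentiable with derivative `dualLin`. [folklore] -/
theorem hasFDerivAt_dualMap (n : ℕ) (t : Fin n → ℝ) : HasFDerivAt (dualMap n) (dualLin n) t := by
  have h : dualMap n = fun s => (fun _ => (1 : ℝ)) + dualLin n s := funext (dualMap_eq n)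
  rw [h]
  exact ((dualLin n).hasFDerivAt).const_add _

/-- `|det dualLin| = 1` (an involution). [folklore] -/
theorem abs_det_dualLin (n : ℕ) : |(dualLin n).det| = 1 := by
  have hcomp : (dualLin n : (Fin n → ℝ) →ₗ[ℝ] (Fin n → ℝ)) ∘ₗ (dualLin n : (Fin n → ℝ) →ₗ[ℝ] (Fin n → ℝ)) =
      LinearMap.id := by
    refine LinearMap.ext fun v => ?_
    have h1 : dualLin n (dualLin n v) = v := by
      rw [dualLin_apply, dualLin_apply]
      ext j; simp [Fin.rev_rev]
    simpa using h1
  have hdet : (dualLin n).det * (dualLin n).det = 1 := by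
    rw [ContinuousLinearMap.det, ← LinearMap.det_comp, hcomp, LinearMap.det_id]
  rcases mul_self_eq_one_iff.mp hdet with h | h
  · rw [h, abs_one]
  · rw [h, abs_neg, abs_one]

/-- `dualMap` preserves the open ordered simplex. [cite: Zagier1994, §9] -/
theorem dualMap_mem_openOrderedSimplex {n : ℕ} {t : Fin n → ℝ} (ht : t ∈ KZ.openOrderedSimplex n) :
    dualMap n t ∈ KZ.openOrderedSimplex n := by
  obtain ⟨h0, h1, hanti⟩ := ht
  refine ⟨fun i => ?_, fun i => ?_, fun i j hij => ?_⟩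
  · simp only [dualMap]; linarith [h1 (Fin.rev i)]
  · simp only [dualMap]; linarith [h0 (Fin.rev i)]
  · simp only [dualMap]
    have hr : Fin.rev j < Fin.rev i := Fin.rev_lt_rev.mpr hij
    linarith [hanti hr]

/-- The image of the simplex under `dualMap` is the simplex. [cite: Zagier1994, §9] -/
theorem image_dualMap (n : ℕ) : dualMap n '' KZ.openOrderedSimplex n = KZ.openOrderedSimplex n := by
  ext t
  constructor
  · rintro ⟨s, hs, rfl⟩
    exact dualMap_mem_openOrderedSimplex hs
  · intro ht
    exact ⟨dualMap n t, dualMap_mem_openOrderedSimplex ht, dualMap_dualMap n t⟩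

/-- `dualMap` is a `ℚ`-polynomial, hence `ℚ`-semialgebraic, map on the simplex. [cite: BCR1998, §2.2] -/
theorem isSemialgebraicMapOn_dualMap (n : ℕ) :
    IsSemialgebraicMapOn ℚ (KZ.openOrderedSimplex n) (dualMap n) := by
  have h : dualMap n = fun x j =>
      MvPolynomial.aeval x ((1 : MvPolynomial (Fin n) ℚ) - MvPolynomial.X (Fin.rev j)) := by
    funext x j; simp [dualMap]
  rw [h]
  exact isSemialgebraicMapOn_aeval (KZ.isSemialgebraic_openOrderedSimplex n) _

/-- The integrand identity `ω₀(t₀)ω₀(t₁)ω₁(t₂) = (ω₀ω₁ω₁)(1-t₂,1-t₁,1-t₀)`. [cite: Zagier1994, §9] -/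
theorem mzvIntegrand_three_eq (t : Fin 3 → ℝ) :
    KZ.mzvIntegrand [3] t = KZ.mzvIntegrand [2, 1] (dualMap 3 t) := by
  have hw3 : MZV.binaryWord [3] = [false, false, true] := by decide
  have hw21 : MZV.binaryWord [2, 1] = [false, true, true] := by decide
  have r0 : Fin.rev (0 : Fin 3) = 2 := by decide
  have r1 : Fin.rev (1 : Fin 3) = 1 := by decide
  have r2 : Fin.rev (2 : Fin 3) = 0 := by decide
  unfold KZ.mzvIntegrand
  rw [hw3, hw21]
  show (∏ i : Fin 3, KZ.mzvForm ([false, false, true].getD i false) (t i)) =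
    ∏ i : Fin 3, KZ.mzvForm ([false, true, true].getD i false) (1 - t (Fin.rev i))
  simp only [Fin.prod_univ_three, r0, r1, r2]
  simp [KZ.mzvForm]
  ring

/-- **EULER'S `ζ(3) = ζ(2,1)` IS ONE MOVE**: the simplex representations of `ζ(3)` and `ζ(2,1)`
differ by a single change of variables (rule 2) along the duality involution
`t ↦ (1 - t₂, 1 - t₁, 1 - t₀)` — the instance `s = (3)` of the support item `DualityInKZ`.
[cite: Zagier1994, §9; KontsevichZagier2001, §1.2 rule (2)] -/
theorem mzvRep_three_sub_twoOne_mem_relations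
    (a : IsSemialgebraicFunOn ℚ (KZ.openOrderedSimplex (MZV.weight [3])) (KZ.mzvIntegrand [3]))
    (b : IntegrableOn (KZ.mzvIntegrand [3]) (KZ.openOrderedSimplex (MZV.weight [3])) volume)
    (a' : IsSemialgebraicFunOn ℚ (KZ.openOrderedSimplex (MZV.weight [2, 1])) (KZ.mzvIntegrand [2, 1]))
    (b' : IntegrableOn (KZ.mzvIntegrand [2, 1]) (KZ.openOrderedSimplex (MZV.weight [2, 1])) volume) :
    KZ.of (KZ.mzvRep [3] (by decide) a b) - KZ.of (KZ.mzvRep [2, 1] (by decide) a' b') ∈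
      KZ.relations := by
  refine KZ.changeOfVariablesRel_subset_relations ⟨MZV.weight [3], KZ.mzvRep [3] (by decide) a b,
    KZ.mzvRep [2, 1] (by decide) a' b', dualMap _, fun _ => dualLin _, ?_, ?_, ?_, ?_, ?_, rfl⟩
  · rw [KZ.mzvRep_domain]
    exact isSemialgebraicMapOn_dualMap _
  · intro x _
    exact (hasFDerivAt_dualMap _ x).hasFDerivWithinAt
  · intro x _ y _ hxy
    rw [← dualMap_dualMap _ x, hxy, dualMap_dualMap]
  · rw [KZ.mzvRep_domain, KZ.mzvRep_domain]
    exact (image_dualMap _).symm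
  · intro t _
    rw [abs_det_dualLin, mul_one]
    exact mzvIntegrand_three_eq t

/-! ## §16h Unconditional tightness modulo weight 4 -/

section Unconditional

variable {R : Type} [CommRing R] [Algebra ℚ R] {χ : KZ.FormalRep →+ R} {Z : List ℕ → KZ.FormalRep}

omit [Algebra ℚ R] in
/-- **`χ⟦ζ(3)⟧ = χ⟦ζ(2,1)⟧` in EVERY realisation of the rules** (one change of variables).
[cite: Zagier1994, §9] -/
theorem chi_Z3_eq_Z21 (hχ : IsRealisation R χ) (hZ : AgreesWithSimplex Z) :
    χ (Z [3]) = χ (Z [2, 1]) := by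
  have h := hχ.rel _ (mzvRep_three_sub_twoOne_mem_relations
    (KZ.mzvIntegrand_isSemialgebraicFunOn_holds [3]) (KZ.mzvIntegrand_integrableOn_holds [3] (by decide))
    (KZ.mzvIntegrand_isSemialgebraicFunOn_holds [2, 1])
    (KZ.mzvIntegrand_integrableOn_holds [2, 1] (by decide)))
  rw [map_sub, sub_eq_zero] at h
  rw [hZ [3] (by decide), hZ [2, 1] (by decide)]
  exact h

/-- **THE CRUX HOLDS UNCONDITIONALLY MODULO WEIGHT 4**: for every realisation `χ` of the rules and
every agreeing `Z`, `Φ_χ` satisfies Drinfeld's pentagon identity in `U𝔞₄ ⊗ R/(deg > N)` for all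
`N ≤ 3`.  (Level `≤ 2`: regularisation + locality, gen. 2; level 3: Lie shape + `D[K₂] = 0` +
`D[U] = D[V]` + the duality move.)  A refutation of `PentagonInKZ` must therefore live in weight
`≥ 4`. [cite: Furusho2011, §2] -/
theorem pentAt_le_three (hχ : IsRealisation R χ) (hZ : AgreesWithSimplex Z) :
    ∀ N ≤ 3, NCSeries.PentAt (cruxSeries R χ Z) N :=
  pentAt_le_three_of_duality hχ hZ (chi_Z3_eq_Z21 hχ hZ)

/-- In particular the rules associator's pentagon defect starts in weight `≥ 4`: stated for the
crux's own quantifier shape. [cite: Furusho2011, §2] -/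
theorem pentagonInKZ_mod_weight_four :
    ∀ (R : Type) [CommRing R] [Algebra ℚ R] (χ : KZ.FormalRep →+ R),
      (∀ c ∈ KZ.relations, χ c = 0) → (∀ a b, χ (a * b) = χ a * χ b) → (∃ u, χ u = 1) →
      ∀ Z : List ℕ → KZ.FormalRep, AgreesWithSimplex Z →
        ∀ N ≤ 3, NCSeries.PentAt (cruxSeries R χ Z) N :=
  fun R _ _ _ h1 h2 h3 _ hZ => pentAt_le_three (R := R) ⟨h1, h2, h3⟩ hZ

end Unconditional

end Summit.KontsevichZagierPeriods.FurushoPentagon.PentagonInKZNegative
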